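import Summits.BirchSwinnertonDyer.BirchSwinnertonDyer.Theorems.ErratumRoadFiveNonSurjCornerKolyJProp44PairSelmer
import Summits.BirchSwinnertonDyer.BirchSwinnertonDyer.Theorems.KatoDescentTamePotSupersingularJetchevIrreducibleProp44AHalfRows
import Summits.BirchSwinnertonDyer.BirchSwinnertonDyer.Theorems.Rank1ResidualJetRingClassFields
import Literature.NumberTheory.EllipticCurves.GrossLMS1991.HeegnerEulerSystemCongruenceInert
import HarnessLib

/-!
# Crux `JetchevIrreducibleReadingByName` (item 20165, shared K8-t′ / K9), stub S5: the PRIMED (B)-ONLY reading of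
# [McC] Prop. 4.4 / [J] Prop. 4.7 at ODD Kolyvagin levels IS A THEOREM modulo the planner's preferred published fact
# `GrossLMS1991.prop37_2_reductionCongruence_inert N W K` (Gross 1991 Prop. 3.7 (2) = Nekovář 2007 Prop. 4.9, p-free, per row)
# — seat `bsd-potss-k8t-c4` g11; `--supports 20165`, helper; route-free; CONDITIONAL on that named fact; nothing booked, no item
# closed, BSD is not proved by any of this

WHY. Sibling of `JetchevIrreducibleProp44.h47P2_of_prop37_2` (this seat, p541604), which closes the S5 lane modulo the IMAGE-FREE
fact `GrossLMS1991.prop37_2_frobeniusCongruence` with the guard `l ≠ 2` on the swapped prime only. The planner's SPEC (INBOX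
2026-08-27T14:58:56Z, step (c)) keys the S5 re-cut on the per-row PREDICATE fact `prop37_2_reductionCongruence_inert N W K`
(version 2, ARM P R-43: its level clause asks the WHOLE square-free level to be ODD, or Gross's surjective setting) consumed
through `.congruence` / `.family_of_zhangKolyvaginPrime`. This file gives that variant: the guard becomes «the level `mℓ` is odd»
(`∀ q ∈ (m * l).primeFactors, q ≠ 2`) — automatic for `p ≠ 3` (`GrossLMS1991.zhangKolyvaginPrime_ne_two`), a genuine condition at
`p = 3` (K9 face) that the H63 machine can only meet if its CORE VERTEX is odd (S3′'s business; the planner decides whether to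
prime S3′/the rows or to bind the image-free fact instead — both closures are now in the tree). Proof identical to p541604's:
corner-p1's pair END p539541 + this seat's (A)-half and dischargers p530898, with (γ) fed by the inert fact's `.congruence`.

WHAT IS PROVED. `h47P3_of_prop37_2_inert` : (∀ rows, `prop37_2_reductionCongruence_inert (W.conductorNorm ℤ) W K`) → h47P3, where
h47P3 := `Sig.stub_prop44Irred` primed with `(p : ℤ) ∣ W.conductorNorm ℤ`, (B)-only, with the level-odd guard after `l.Prime`.
HONEST FRAMING: CONDITIONAL on the displayed published fact; nothing asserted about any curve; the crux and BSD stay open.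

References: [cite: GrossLMS1991, Prop. 3.7 (2) (p. 240)] [cite: Nekovar2007, Prop. 4.9, Prop. 4.13 (ii)] [cite: McCallumLMS1991, §4 Prop. 4.4]
[cite: Jetchev2008, Prop. 4.4, Prop. 4.7, Rem. 6.2] [cite: WZhang2014, Notations (xii)].
-/

set_option autoImplicit false
-- the Theorems directory repeats the summit name (sibling precedent `KatoDescentPotSupersingularAssembly.lean`)
set_option linter.dupNamespace false

noncomputable section

open scoped Classical Pointwise

open WeierstrassCurve NumberField IsDedekindDomain Field
  Literature.NumberTheory.GaloisRepresentations Literature.NumberTheory.EllipticCurves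
  Literature.NumberTheory.EllipticCurves.KolyvaginCocycle Literature.NumberTheory.EllipticCurves.ModularForms
  Summit.BirchSwinnertonDyer.Rank1Residual Summit.BirchSwinnertonDyer.Rank1Residual.X11b
  Summit.BirchSwinnertonDyer.Rank1Residual.X11b.Three

namespace Summit.BirchSwinnertonDyer.BirchSwinnertonDyer.Theorems.JetchevIrreducibleProp44

/-- **S5′ at ODD levels from the per-row fact `prop37_2_reductionCongruence_inert`.** For compatible data `(d, d')` at `(m, mℓ)`,
`mℓ` odd: corner-p1's pair END (p539541) with (γ) := the fact's `.congruence` (level clause by oddness, inertness guard from the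
Zhang–Kolyvagin record), `hA`/`hPt` by the irreducible dischargers, and the (A)-half (p530898) at the top. CONDITIONAL on the fact.
[cite: GrossLMS1991, Prop. 3.7 (2)] [cite: Nekovar2007, Prop. 4.9] [cite: McCallumLMS1991, §4 Prop. 4.4] [cite: Jetchev2008, Prop. 4.7] -/
theorem h47P3_of_prop37_2_inert
    (h37 : ∀ (W : WeierstrassCurve ℚ) [W.IsElliptic] [W.IsGloballyMinimal] [NeZero (W.conductorNorm ℤ)]
      (K : Type) [Field K] [NumberField K],
      GrossLMS1991.prop37_2_reductionCongruence_inert (W.conductorNorm ℤ) W K) :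
    ∀ (W : WeierstrassCurve ℚ) [W.IsElliptic] [W.IsGloballyMinimal] [NeZero (W.conductorNorm ℤ)],
        ¬ W.HasCM →
        ∀ (K : Type) [Field K] [NumberField K], IsImaginaryQuadratic K →
        NumberField.discr K ≠ -3 → NumberField.discr K ≠ -4 →
        SatisfiesHeegnerHypothesis (W.conductorNorm ℤ) K →
        ∀ (p : ℕ) [Fact p.Prime], p ≠ 2 → W.HasIrreducibleModPGaloisRep p → (p : ℤ) ∣ W.conductorNorm ℤ →
        ∀ (Dt : ModularParametrizationData W (W.conductorNorm ℤ)) (β : ℤ) (ι : K →+* ℂ)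
          (M : ℕ), 1 ≤ M →
        ∀ (m l : ℕ), Squarefree (m * l) → l.Prime → (∀ q ∈ (m * l).primeFactors, q ≠ 2) → ¬ l ∣ m →
          (∀ l' ∈ (m * l).primeFactors, Zhang2014.IsKolyvaginPrime (W.conductorNorm ℤ) W K p l' ∧
            M ≤ Zhang2014.kolyvaginIndex W p l') →
        ∀ (d : KolyvaginHeegnerData Dt β ι m) (d' : KolyvaginHeegnerData Dt β ι (m * l)),
          (∀ l' ∈ m.primeFactors, ∀ (x : ringClassField K ι m) (x' : ringClassField K ι (m * l)),
            (x : ℂ) = x' → ((d'.σ l' x' : ringClassField K ι (m * l)) : ℂ) = (d.σ l' x : ℂ)) →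
          (∀ s ∈ d.S, ∃ s' ∈ d'.S, ∀ (x : ringClassField K ι m) (x' : ringClassField K ι (m * l)),
            (x : ℂ) = x' → ((s' x' : ringClassField K ι (m * l)) : ℂ) = (s x : ℂ)) →
          (∀ s' ∈ d'.S, ∃ s ∈ d.S, ∀ (x : ringClassField K ι m) (x' : ringClassField K ι (m * l)),
            (x : ℂ) = x' → ((s' x' : ringClassField K ι (m * l)) : ℂ) = (s x : ℂ)) →
          (∀ (x : ringClassField K ι m) (x' : ringClassField K ι (m * l)),
            (x : ℂ) = x' → d'.emb x' = d.emb x) →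
        ∀ (v : HeightOneSpectrum (𝓞 K)), (l : 𝓞 K) ∈ v.asIdeal →
        ∀ (j : ℕ),
          (((p ^ j : ℕ) : ℤ) • d'.kolyvaginClass (Fact.out : p.Prime) M ∈
              (W.baseChange K).torsionLocalKer (v.adicCompletion K) ((p ^ M : ℕ) : ℤ) ↔
            ((p ^ j : ℕ) : ℤ) • d.kolyvaginClass (Fact.out : p.Prime) M ∈
              (W.baseChange K).torsionLocalKer (v.adicCompletion K) ((p ^ M : ℕ) : ℤ)) := by
  intro W _ _ _ _ K _ _ hK hD3 hD4 hH p _ hp2 hirr hpN Dt β ι M hM m l hml hl hodd hlm hK' d d' hσ hS hS' hemb v hv j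
  have hp : p.Prime := Fact.out
  have hn0 : m * l ≠ 0 := hml.ne_zero
  have hln : l ∈ (m * l).primeFactors := Nat.mem_primeFactors.mpr ⟨hl, dvd_mul_left l m, hn0⟩
  have hml' : m * l / l = m := Nat.mul_div_cancel m hl.pos
  have hpN' : p ∣ W.conductorNorm ℤ := Int.natCast_dvd_natCast.mp hpN
  have hD : NumberField.discr K < -4 := KolyvaginAssembly.discr_lt_neg_four hK ⟨hD3, hD4⟩
  have hinert : ∀ q ∈ (m * l).primeFactors, ¬ q ∣ W.conductorNorm ℤ ∧ ¬ ((q : ℤ) ∣ NumberField.discr K) ∧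
      (Ideal.span {(q : 𝓞 K)}).IsPrime :=
    fun q hq ↦ ⟨(hK' q hq).1.2.1, (hK' q hq).1.2.2.1, (hK' q hq).1.2.2.2.2.1⟩
  haveI : ∀ k : ℕ, NumberField (ringClassField K ι k) := fun k ↦
    Summit.BirchSwinnertonDyer.Rank1Residual.JET.numberField_ringClassField K hK ι k
  -- standing inputs of the two classes (irreducibility + `p` unramified in `K`; KolyCert)
  obtain ⟨hA', hPt'⟩ := isAdmissible_and_mem_invPoints_of_irreducible_of_heegner hK ι W hD3 hD4 hH hp2 hirr hpN'
    Dt β hml hK' d'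
  have hKm : ∀ q ∈ m.primeFactors, Zhang2014.IsKolyvaginPrime (W.conductorNorm ℤ) W K p q ∧
      M ≤ Zhang2014.kolyvaginIndex W p q :=
    fun q hq ↦ hK' q (Nat.primeFactors_mono (dvd_mul_right m l) hn0 hq)
  obtain ⟨hA, hPt⟩ := isAdmissible_and_mem_invPoints_of_irreducible_of_heegner hK ι W hD3 hD4 hH hp2 hirr hpN'
    Dt β (hml.squarefree_of_dvd (dvd_mul_right m l)) hKm d
  -- (γ) at the pair, from the per-row fact (level `mℓ` odd)
  have hγ : ∀ [Fact l.Prime] (hΔ : ¬ (l : ℤ) ∣ minimalDiscriminantInt W)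
      (φ₀ : absoluteGaloisGroup (ZMod l)), (∀ x : AlgebraicClosure (ZMod l), φ₀ • x = x ^ l) →
      ∀ (hle : ringClassField K ι m ≤ ringClassField K ι (m * l))
        (γ : ringClassField K ι (m * l) ≃ₐ[ℚ] ringClassField K ι (m * l)), γ ∈ ringClassGal ι (m * l) →
        geomReduction hΔ ((RatClosure.pointsEquiv (K := K) W).symm
            (d'.toGeomPoints (pointGalHom W (ringClassField K ι (m * l)) γ d'.y))) =
          φ₀ • geomReduction hΔ ((RatClosure.pointsEquiv (K := K) W).symm
            (d'.toGeomPoints (pointGalHom W (ringClassField K ι (m * l)) γ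
              (WeierstrassCurve.Affine.Point.map (W' := W)
                (letI : Algebra K ℂ := ι.toAlgebra; (RingClassField.inclusion ι hle).restrictScalars ℚ)
                d.y)))) := by
    have key : ∀ (m₀ : ℕ) (e : m * l / l = m₀) (d₀ : KolyvaginHeegnerData Dt β ι m₀) [Fact l.Prime]
        (hΔ : ¬ (l : ℤ) ∣ minimalDiscriminantInt W)
        (φ₀ : absoluteGaloisGroup (ZMod l)), (∀ x : AlgebraicClosure (ZMod l), φ₀ • x = x ^ l) →
        ∀ (hle : ringClassField K ι m₀ ≤ ringClassField K ι (m * l))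
          (γ : ringClassField K ι (m * l) ≃ₐ[ℚ] ringClassField K ι (m * l)), γ ∈ ringClassGal ι (m * l) →
          geomReduction hΔ ((RatClosure.pointsEquiv (K := K) W).symm
              (d'.toGeomPoints (pointGalHom W (ringClassField K ι (m * l)) γ d'.y))) =
            φ₀ • geomReduction hΔ ((RatClosure.pointsEquiv (K := K) W).symm
              (d'.toGeomPoints (pointGalHom W (ringClassField K ι (m * l)) γ
                (WeierstrassCurve.Affine.Point.map (W' := W)
                  (letI : Algebra K ℂ := ι.toAlgebra; (RingClassField.inclusion ι hle).restrictScalars ℚ)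
                  d₀.y)))) := by
      intro m₀ e
      subst e
      intro d₀ _ hΔ φ₀ hφ₀ hle γ hγm
      exact GrossLMS1991.prop37_2_reductionCongruence_inert.congruence (N := W.conductorNorm ℤ) (W := W) (K := K)
        (h37 W K) rfl hK ⟨hD3, hD4⟩ hH Dt β ι hml (Or.inl hodd) hinert hln d' d₀ hΔ hφ₀ hle hγm
    intro _ hΔ φ₀ hφ₀ hle γ hγm
    exact key m hml' d hΔ φ₀ hφ₀ hle γ hγm
  -- the pair END (corner-p1 g10): `Sel_λ` for `c(d')` ↔ `Ker_λ` for `c(d)`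
  have hpair := Prop44.zsmul_kolyvaginClass_mem_selmerLocalKer_iff_of_compat hK ι hD hH Dt hp hp2 hM hml hK' hln
    hml' d' d hσ hS hS' hemb hγ hA' hA hPt' hPt v hv j
  -- the (A)-half at the top (this seat g10)
  have hAtop := zsmul_kolyvaginClass_mem_selmerLocalKer_iff_mem_torsionLocalKer_of_irreducible_of_heegner hK ι W
    hD3 hD4 hH hp2 hirr hpN' Dt β hml hln hK' d' v hv ((p : ℤ) ^ j)
  rw [show ((p ^ j : ℕ) : ℤ) = (p : ℤ) ^ j from Nat.cast_pow p j]
  exact hAtop.symm.trans hpair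

end Summit.BirchSwinnertonDyer.BirchSwinnertonDyer.Theorems.JetchevIrreducibleProp44

end
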